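import Literature.Analysis.FluidPDE.KatoBilinearEstimates
import Literature.Analysis.FluidPDE.OseenSlice
import Literature.Analysis.FluidPDE.TaoBoundedTotalSpeed
import Literature.Analysis.FluidPDE.LerayHopfTranslate
import HarnessLib

/-!
# Tao 2021, Prop. 3.1 (ii), step 2: tools for the total-speed estimate

Analysis/FluidPDE proof file (theorems only, no named facts), step 6c of the inline programme
for `Literature.Analysis.FluidPDE.tao_quantitative_ess` (Tao 2021, Thm. 1.2). Tools for the
proof of the bounded total speed estimate (3.4) (arXiv:1908.04958v2, Prop. 3.1 (ii), p. 12),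
in the tree's Oseen vocabulary:

* `exists_enorm_oseenSlice_le_top_six` — the cross-term slice bound
  `‖N_σ[a,b](x)‖ ≤ C σ^{-3/4} ‖a‖_∞ ‖b‖₆` (and symmetrically), from the envelope bound
  `‖Env_σ‖_{6/5} ∝ σ^{-3/4}` of `OseenKernelLp.lean` (Lemarié-Rieusset 2016, Prop. 6.4 /
  Kato 1984, (2.3)) — Tao's "(2.3), Hölder's inequality, and (3.11), (3.15)";
* `lintegral_Ioo_rpow_neg_three_quarters_sub_le` (with the tree's `setLIntegral_Ioo_comp_add_right`),
  `lintegral_Ioo_volterra_le` — the time bookkeeping `∫₀^{T'} ∫₀ʳ (r−τ)^{-3/4} G(τ) dτ dr ≤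
  4T'^{1/4} ∫₀^{T'} G` (Tonelli);
* `lintegral_Ioo_sqrt_le` — Cauchy–Schwarz in time, `∫₀^{T'} F^{1/2} ≤ T'^{1/2} (∫₀^{T'} F)^{1/2}`;
* `measurable_lintegral_frobeniusNormSq_of_continuous` — measurability of
  `τ ↦ ∫ |D(τ,x)|²_F dx` for a jointly continuous matrix field.

## References

* T. Tao, arXiv:1908.04958v2 (2021), Prop. 3.1 (ii), proof p. 12. [Tao2021QuantitativeNS]
* P. G. Lemarié-Rieusset, *The Navier–Stokes Problem in the 21st Century*, CRC 2016, Prop. 6.4,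
  Thm. 7.5. [LemarieRieusset2016]
-/

noncomputable section

open MeasureTheory Set Function Filter Topology
open scoped ENNReal NNReal

namespace Literature.Analysis.FluidPDE

/-! ## Hölder exponents and the cross-term slice bound -/

section Slice

/-- `(6/5).toReal = 6/5`, `1 ≤ 6/5 ≠ ∞` in `ℝ≥0∞`. [folklore] -/
theorem six_fifths_facts :
    (6 / 5 : ℝ≥0∞).toReal = 6 / 5 ∧ (1 : ℝ≥0∞) ≤ 6 / 5 ∧ (6 / 5 : ℝ≥0∞) ≠ ⊤ := by
  refine ⟨by rw [ENNReal.toReal_div, ENNReal.toReal_ofNat, ENNReal.toReal_ofNat], ?_,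
    ENNReal.div_ne_top (by norm_num) (by norm_num)⟩
  exact (ENNReal.le_div_iff_mul_le (Or.inl (by norm_num)) (Or.inl (by norm_num))).2 (by norm_num)

/-- **The cross-term slice bound.** There is an absolute `C` with
`‖N_σ[a,b](x)‖ ≤ C σ^{-3/4} ‖a‖_{L^∞} ‖b‖_{L⁶}` and `‖N_σ[a,b](x)‖ ≤ C σ^{-3/4} ‖a‖_{L⁶} ‖b‖_{L^∞}`
for all `σ > 0`, measurable `a, b : ℝ³ → ℝ³` and every point `x` (envelope `‖Env_σ‖_{6/5} ∝
σ^{3/(2·6/5) − 2} = σ^{-3/4}`, Hölder `‖|a||b|‖₆ ≤ ‖a‖_∞‖b‖₆`).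
[cite: LemarieRieusset2016, Prop. 6.4 and Thm. 7.5 (proof, PDF p. 157)] -/
theorem exists_enorm_oseenSlice_le_top_six :
    ∃ C : ℝ≥0, ∀ σ : ℝ, 0 < σ →
      ∀ (a b : EuclideanSpace ℝ (Fin 3) → EuclideanSpace ℝ (Fin 3)),
      AEStronglyMeasurable a volume → AEStronglyMeasurable b volume →
      ∀ x : EuclideanSpace ℝ (Fin 3),
        ‖oseenSlice σ a b x‖ₑ ≤ C * ENNReal.ofReal (σ ^ (-(3 / 4 : ℝ))) *
            (eLpNorm a ∞ volume * eLpNorm b 6 volume) ∧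
        ‖oseenSlice σ a b x‖ₑ ≤ C * ENNReal.ofReal (σ ^ (-(3 / 4 : ℝ))) *
            (eLpNorm a 6 volume * eLpNorm b ∞ volume) := by
  haveI := holderTriple_sixFifths_six_one
  obtain ⟨h65, h1, hne⟩ := six_fifths_facts
  obtain ⟨C, hC, hK⟩ := exists_norm_oseenKernel_le (E := EuclideanSpace ℝ (Fin 3))
  obtain ⟨Cr, hCr0, hEnv⟩ := exists_eLpNorm_oseenEnvelope_le (E := EuclideanSpace ℝ (Fin 3)) hC.le
    (r := 6 / 5) h1 hne
  refine ⟨Cr.toNNReal, fun σ hσ a b ha hb x => ?_⟩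
  have hexp : ((Module.finrank ℝ (EuclideanSpace ℝ (Fin 3)) : ℝ) / (2 * (6 / 5 : ℝ≥0∞).toReal) -
      (((Module.finrank ℝ (EuclideanSpace ℝ (Fin 3)) : ℝ) + 1) / 2)) = -(3 / 4 : ℝ) := by
    rw [finrank_euclideanSpace_fin, h65]; norm_num
  have hE : eLpNorm (fun z : EuclideanSpace ℝ (Fin 3) => C * (σ + ‖z‖ ^ 2) ^
      (-(((Module.finrank ℝ (EuclideanSpace ℝ (Fin 3)) : ℝ) + 1) / 2))) (6 / 5) volume ≤
      Cr.toNNReal * ENNReal.ofReal (σ ^ (-(3 / 4 : ℝ))) := by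
    refine (hEnv σ hσ).trans (le_of_eq ?_)
    rw [hexp, ENNReal.ofReal_mul hCr0, ← ENNReal.ofReal_coe_nnreal, Real.coe_toNNReal _ hCr0]
  have hslice := enorm_oseenSlice_le_eLpNorm_mul hC.le hK hσ ha hb (6 / 5) 6 x
  rw [← oseenSlice_apply] at hslice
  constructor
  · calc ‖oseenSlice σ a b x‖ₑ ≤ _ := hslice
      _ ≤ (Cr.toNNReal * ENNReal.ofReal (σ ^ (-(3 / 4 : ℝ)))) *
          (eLpNorm a ∞ volume * eLpNorm b 6 volume) :=
          mul_le_mul' hE (eLpNorm_norm_mul_norm_le ha hb ∞ 6 6)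
  · calc ‖oseenSlice σ a b x‖ₑ ≤ _ := hslice
      _ ≤ (Cr.toNNReal * ENNReal.ofReal (σ ^ (-(3 / 4 : ℝ)))) *
          (eLpNorm a 6 volume * eLpNorm b ∞ volume) :=
          mul_le_mul' hE (eLpNorm_norm_mul_norm_le ha hb 6 ∞ 6)

/-- A continuous function with `‖f‖_{L^∞} ≤ C` is bounded by `C` everywhere (real form;
private copy of the tree's `norm_le_of_eLpNorm_top_le`, outside this file's imports). [folklore] -/
theorem norm_le_of_eLpNorm_top_le_cont {F' : Type*} [NormedAddCommGroup F']
    {f : EuclideanSpace ℝ (Fin 3) → F'} (hf : Continuous f) {C : ℝ} (hC0 : 0 ≤ C)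
    (hC : eLpNorm f ∞ volume ≤ ENNReal.ofReal C) (x : EuclideanSpace ℝ (Fin 3)) : ‖f x‖ ≤ C := by
  by_contra hlt
  have hlt' : C < ‖f x‖ := not_le.1 hlt
  set U : Set (EuclideanSpace ℝ (Fin 3)) := {y | C < ‖f y‖} with hU
  have hUo : IsOpen U := isOpen_lt continuous_const hf.norm
  have hUpos : 0 < volume U := hUo.measure_pos volume ⟨x, hlt'⟩
  have hae : ∀ᵐ y ∂(volume : Measure (EuclideanSpace ℝ (Fin 3))), ‖f y‖ ≤ C := by
    have h1 := ae_le_eLpNormEssSup (f := f) (μ := (volume : Measure (EuclideanSpace ℝ (Fin 3))))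
    rw [← eLpNorm_exponent_top] at h1
    filter_upwards [h1] with y hy
    have hy' : ‖f y‖ₑ ≤ ENNReal.ofReal C := hy.trans hC
    rw [← ofReal_norm] at hy'
    exact (ENNReal.ofReal_le_ofReal_iff hC0).1 hy'
  have hU0 : volume U = 0 := by
    refine measure_eq_zero_iff_ae_notMem.2 ?_
    filter_upwards [hae] with y hy hyU
    exact absurd hyU (not_lt.2 hy)
  exact absurd hU0 hUpos.ne'

end Slice

/-! ## Time bookkeeping: translations, the Volterra kernel `(r − τ)^{-3/4}`, Tonelli -/

section Time

/-- `∫_{(τ, T')} (r − τ)^{-3/4} dr ≤ 4 T'^{1/4}` for `0 ≤ τ` (`= 4(T' − τ)^{1/4}` if `τ < T'`,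
and `0` otherwise). [folklore] -/
theorem lintegral_Ioo_rpow_neg_three_quarters_sub_le {τ T' : ℝ} (hτ : 0 ≤ τ) :
    ∫⁻ r in Ioo τ T', ENNReal.ofReal ((r - τ) ^ (-(3 / 4 : ℝ))) ≤
      ENNReal.ofReal (4 * T' ^ (1 / 4 : ℝ)) := by
  rcases le_or_gt T' τ with hle | hlt
  · rw [Ioo_eq_empty (not_lt.2 hle), Measure.restrict_empty, lintegral_zero_measure]
    exact zero_le
  · have h := setLIntegral_Ioo_comp_add_right (fun r => ENNReal.ofReal ((r - τ) ^ (-(3 / 4 : ℝ))))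
      0 (T' - τ) τ
    simp only [add_sub_cancel_right, zero_add, sub_add_cancel] at h
    rw [← h, lintegral_rpow_neg_three_quarters (sub_pos.2 hlt)]
    refine ENNReal.ofReal_le_ofReal (mul_le_mul_of_nonneg_left ?_ (by norm_num))
    exact Real.rpow_le_rpow (sub_nonneg.2 hlt.le) (by linarith) (by norm_num)

/-- **The Volterra kernel against a measurable weight, integrated in time (Tonelli).** For a
measurable `G : ℝ → ℝ≥0∞` and `T' > 0`,
`∫_{(0,T')} ( ∫_{(0,r)} (r−τ)^{-3/4} G(τ) dτ ) dr ≤ 4T'^{1/4} ∫_{(0,T')} G(τ) dτ`. [folklore] -/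
theorem lintegral_Ioo_volterra_le {G : ℝ → ℝ≥0∞} (hG : Measurable G) (T' : ℝ) :
    ∫⁻ r in Ioo 0 T', ∫⁻ τ in Ioo 0 r, ENNReal.ofReal ((r - τ) ^ (-(3 / 4 : ℝ))) * G τ ≤
      ENNReal.ofReal (4 * T' ^ (1 / 4 : ℝ)) * ∫⁻ τ in Ioo 0 T', G τ := by
  -- the kernel, extended by zero to `τ ≥ r`
  set J : ℝ → ℝ → ℝ≥0∞ := fun r τ =>
    (Ioi τ).indicator (fun r => ENNReal.ofReal ((r - τ) ^ (-(3 / 4 : ℝ)))) r with hJ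
  have hJmeas : Measurable (uncurry fun r τ => J r τ * G τ) := by
    have hset : MeasurableSet {p : ℝ × ℝ | p.2 < p.1} := measurableSet_lt measurable_snd measurable_fst
    have hrep : (uncurry fun r τ => J r τ * G τ) = fun p : ℝ × ℝ =>
        {p : ℝ × ℝ | p.2 < p.1}.indicator
          (fun p => ENNReal.ofReal ((p.1 - p.2) ^ (-(3 / 4 : ℝ))) * G p.2) p := by
      funext p
      simp only [uncurry, hJ, indicator, mem_Ioi, mem_setOf_eq]
      split_ifs <;> simp
    rw [hrep]
    exact (((measurable_fst.sub measurable_snd).pow_const _).ennreal_ofReal.mul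
      (hG.comp measurable_snd)).indicator hset
  have hJr : ∀ τ, Measurable fun r => J r τ := fun τ =>
    ((measurable_id.sub measurable_const).pow_const _).ennreal_ofReal.indicator measurableSet_Ioi
  -- Step 1: enlarge the inner domain
  have h1 : ∀ r ∈ Ioo 0 T', ∫⁻ τ in Ioo 0 r, ENNReal.ofReal ((r - τ) ^ (-(3 / 4 : ℝ))) * G τ ≤
      ∫⁻ τ in Ioo 0 T', J r τ * G τ := by
    intro r hr
    calc ∫⁻ τ in Ioo 0 r, ENNReal.ofReal ((r - τ) ^ (-(3 / 4 : ℝ))) * G τ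
        = ∫⁻ τ in Ioo 0 r, J r τ * G τ := by
          refine setLIntegral_congr_fun measurableSet_Ioo fun τ hτ => ?_
          simp only [hJ, indicator, mem_Ioi, hτ.2, if_true]
      _ ≤ ∫⁻ τ in Ioo 0 T', J r τ * G τ := lintegral_mono_set (Ioo_subset_Ioo_right hr.2.le)
  -- Step 2: Tonelli and the kernel integral
  have h2 : ∀ τ ∈ Ioo 0 T', ∫⁻ r in Ioo 0 T', J r τ * G τ ≤
      ENNReal.ofReal (4 * T' ^ (1 / 4 : ℝ)) * G τ := by
    intro τ hτ
    rw [lintegral_mul_const _ (hJr τ)]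
    gcongr
    have hind : ∫⁻ r in Ioo 0 T', J r τ = ∫⁻ r in Ioo τ T', ENNReal.ofReal ((r - τ) ^ (-(3 / 4 : ℝ))) := by
      simp only [hJ]
      rw [lintegral_indicator measurableSet_Ioi, Measure.restrict_restrict measurableSet_Ioi]
      congr 1
      rw [Ioi_inter_Ioo, max_eq_left hτ.1.le]
    rw [hind]
    exact lintegral_Ioo_rpow_neg_three_quarters_sub_le hτ.1.le
  calc ∫⁻ r in Ioo 0 T', ∫⁻ τ in Ioo 0 r, ENNReal.ofReal ((r - τ) ^ (-(3 / 4 : ℝ))) * G τ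
      ≤ ∫⁻ r in Ioo 0 T', ∫⁻ τ in Ioo 0 T', J r τ * G τ := setLIntegral_mono' measurableSet_Ioo h1
    _ = ∫⁻ τ in Ioo 0 T', ∫⁻ r in Ioo 0 T', J r τ * G τ :=
        lintegral_lintegral_swap hJmeas.aemeasurable
    _ ≤ ∫⁻ τ in Ioo 0 T', ENNReal.ofReal (4 * T' ^ (1 / 4 : ℝ)) * G τ :=
        setLIntegral_mono' measurableSet_Ioo h2
    _ = _ := lintegral_const_mul' _ _ ENNReal.ofReal_ne_top

/-- **Cauchy–Schwarz in time**: `∫_{(0,T')} F^{1/2} ≤ T'^{1/2} (∫_{(0,T')} F)^{1/2}` for an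
a.e.-measurable `F : ℝ → ℝ≥0∞`. [folklore] -/
theorem lintegral_Ioo_sqrt_le {F : ℝ → ℝ≥0∞} {T' : ℝ}
    (hF : AEMeasurable F (volume.restrict (Ioo 0 T'))) :
    ∫⁻ τ in Ioo 0 T', F τ ^ (1 / 2 : ℝ) ≤
      ENNReal.ofReal T' ^ (1 / 2 : ℝ) * (∫⁻ τ in Ioo 0 T', F τ) ^ (1 / 2 : ℝ) := by
  have h := ENNReal.lintegral_mul_le_Lp_mul_Lq (volume.restrict (Ioo 0 T'))
    Real.HolderConjugate.two_two (aemeasurable_const (b := (1 : ℝ≥0∞)))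
    (hF.pow_const (1 / 2 : ℝ))
  have e2 : ∫⁻ _ in Ioo 0 T', (1 : ℝ≥0∞) ^ (2 : ℝ) = ENNReal.ofReal T' := by
    rw [ENNReal.one_rpow, setLIntegral_const, one_mul, Real.volume_Ioo, sub_zero]
  have e3 : ∀ τ, (F τ ^ (1 / 2 : ℝ)) ^ (2 : ℝ) = F τ := fun τ => by
    rw [← ENNReal.rpow_mul]; norm_num
  simp only [Pi.mul_apply, one_mul, e3] at h
  rw [e2] at h
  exact h

end Time

/-! ## Measurability of the enstrophy density of a jointly continuous matrix field -/

section Measurability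

/-- For a jointly continuous matrix field `D : ℝ → ℝ³ → (ℝ³ →L ℝ³)` the enstrophy density
`τ ↦ ∫ |D(τ, x)|²_F dx` (as a `∫⁻`) is measurable (Tonelli measurability; continuity of the
squared Frobenius norm is the tree's `LerayHopfProofs.continuous_frobeniusNormSq`). [folklore] -/
theorem measurable_lintegral_frobeniusNormSq_of_continuous
    {D : ℝ → EuclideanSpace ℝ (Fin 3) → (EuclideanSpace ℝ (Fin 3) →L[ℝ] EuclideanSpace ℝ (Fin 3))}
    (hD : Continuous (uncurry D)) :
    Measurable fun τ => ∫⁻ x, ENNReal.ofReal (frobeniusNormSq (D τ x)) := by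
  have hm : Measurable fun p : ℝ × EuclideanSpace ℝ (Fin 3) =>
      ENNReal.ofReal (frobeniusNormSq (D p.1 p.2)) :=
    (LerayHopfProofs.continuous_frobeniusNormSq.comp hD).measurable.ennreal_ofReal
  exact hm.lintegral_prod_right'

end Measurability

end Literature.Analysis.FluidPDE
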